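import Summits.BirchSwinnertonDyer.BirchSwinnertonDyer.Theorems.AdditiveBranchIMCTwistRootNumberOdd
import Summits.BirchSwinnertonDyer.BirchSwinnertonDyer.Theorems.AdditiveBranchIMCTwistTypeConductorAtThree
import HarnessLib

/-!
# `w(E^{(qℓ)}) = w(E)` at a non-split multiplicative Wan prime `q` — curves with an ADDITIVE `3` OF QUADRATIC-TWIST TYPE (LEAD g13)

Theorems-side variant (theorems only; no definition, no named fact, no `sorry`) of `AdditiveBranchIMCTwistRootNumberOdd.lean` (p744621,
LEAD g11; modular proof for EVERY odd `q`, for curves with no additive reduction at `2, 3` and additive primes `≥ 5` of quadratic-twist type).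
The hypothesis at `3` is weakened to what the proof uses: no additive reduction at `2` (`h2`) and EVERY ODD additive prime of
quadratic-twist type (`htt`; at `3`: `E^{(−3)}` semistable at `3`). The one new input is `f₃(X) = 2` for `X` additive at `3` with a semistable
quadratic twist (`ManinLocalTwoThree.conductorExponent_eq_two_of_isSemistableAt_quadraticTwist_of_three_mem`, Silverman *ATAEC* IV.10.2 /
IV.11.1), applied to `E`, `E^{(qℓ)}` and their `p*`-twists, quadratic-twist type being transported along twists by parameters prime to the
prime in question (`hasReductionAt_quadraticTwist_iff_of_not_dvd`); everything else is p744621 VERBATIM. Purpose: the twist-type sub-row of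
crux 19357 gains the curves with an additive `3` of twist type (LeadReport21 §3.1). BSD is proved for no curve by any of this.
References: [KellockDokchitser2023] Rem. 2.2, Thm. 2.3; [AtkinLi1978] §3; [Knapp1993] Thm. 9.27; [SilvermanATAEC1994] IV.9.4, IV.10–11.
-/

set_option linter.dupNamespace false
set_option autoImplicit false

noncomputable section

open scoped MatrixGroups Classical

open CongruenceSubgroup Literature.NumberTheory.EllipticCurves Literature.NumberTheory.EllipticCurves.ModularForms
  IsDedekindDomain IsDedekindDomain.HeightOneSpectrum NumberField Rat.HeightOneSpectrum WeierstrassCurve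
  Summit.BirchSwinnertonDyer.BirchSwinnertonDyer.Theorems

namespace Summit.BirchSwinnertonDyer.BirchSwinnertonDyer.Theorems.TwistRootNumberOddThree

variable (W : WeierstrassCurve ℚ) [W.IsElliptic] [W.IsGloballyMinimal]

/-- `natGenerator` of the place of `ℤ` under a prime `p` is `p`. [folklore] -/
private theorem natGenerator_symm (p : Nat.Primes) : natGenerator ((primesEquiv (R := ℤ)).symm p) = p :=
  congrArg (fun q : Nat.Primes ↦ (q : ℕ)) ((primesEquiv (R := ℤ)).apply_symm_apply p)

/-! ### §2 The root number of `E^{(qℓ)}`, modular proof -/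

/-- **The root number of a quadratic twist ramified at ONE non-split multiplicative prime — any odd prime `q`, `E` allowed an
additive `3` of quadratic-twist type** (variant of `TwistRootNumberOdd.rootNumber_quadraticTwist_mul_eq_of_nonsplit_odd`): for `E / ℚ`
(global minimal `W`, no additive reduction at `2`, every ODD additive prime of quadratic-twist type), `q` an odd prime of NON-SPLIT
multiplicative reduction, `ℓ ≥ 5` an auxiliary good prime with `qℓ ≡ 1 (mod 8)` and `(qℓ / p) = 1` at every odd prime `p ≠ q` of `N_E`:
`w(E^{(qℓ)}) = w(E)`. MODULAR proof as in p744621 (`w = −ε(f)`, `ε(f) = ∏ λ_p(f)`, Atkin–Li twisting at `q` and `ℓ`, `λ_q(f) = +1`,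
`λ_p(f') = λ_p(f)` elsewhere, `(−1/q)(−1/ℓ) = 1`), with `f_p = 2` at an odd additive prime of twist type (`p ≥ 5` always; `p = 3` tame).
[cite: KellockDokchitser2023, Rem. 2.2 and Thm. 2.3] [cite: AtkinLi1978, §3] [cite: Knapp1993, Thm. 9.27] [cite: SilvermanATAEC1994, Thm. IV.10.2] -/
theorem rootNumber_quadraticTwist_mul_eq_of_nonsplit_odd_twistThree (hmod : exists_isNewformOf)
    (h2 : ∀ v : HeightOneSpectrum ℤ, W.HasAdditiveReductionAt v → 2 < ringChar (ℤ ⧸ v.asIdeal))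
    (htt : ∀ p : Nat.Primes, (p : ℕ) ≠ 2 → W.HasAdditiveReductionAt ((primesEquiv (R := ℤ)).symm p) →
      ¬ (W.quadraticTwist (((-1 : ℤ) ^ ((p : ℕ) / 2) * p : ℤ) : ℚ)).HasAdditiveReductionAt
        ((primesEquiv (R := ℤ)).symm p))
    {q ℓ : ℕ} [hq : Fact q.Prime] [hℓ : Fact ℓ.Prime] (hq2 : q ≠ 2) (hℓ5 : 5 ≤ ℓ) (hqℓ : q ≠ ℓ)
    (hqm : W.HasMultiplicativeReductionAtPrime q) (hqns : ¬ W.HasSplitMultiplicativeReductionAtPrime q)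
    (hℓg : W.HasGoodReductionAtPrime ℓ) (h8 : ((q : ℤ) * ℓ) % 8 = 1)
    (hjac : ∀ p : ℕ, p.Prime → p ∣ W.conductorNorm ℤ → p ≠ 2 → p ≠ q → jacobiSym ((q : ℤ) * ℓ) p = 1) :
    (W.quadraticTwist (((q : ℤ) * ℓ : ℤ) : ℚ)).rootNumber = W.rootNumber := by
  have hℓ2 : ℓ ≠ 2 := by omega
  set d : ℤ := (q : ℤ) * ℓ with hd
  have hd0 : d ≠ 0 := mul_ne_zero (by exact_mod_cast hq.out.ne_zero) (by exact_mod_cast hℓ.out.ne_zero)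
  have hdQ : (d : ℚ) ≠ 0 := by exact_mod_cast hd0
  set W' := W.quadraticTwist (d : ℚ) with hW'
  haveI : W'.IsElliptic := W.isElliptic_quadraticTwist hdQ
  set Pq : Nat.Primes := ⟨q, hq.out⟩
  set Pℓ : Nat.Primes := ⟨ℓ, hℓ.out⟩
  set vq : HeightOneSpectrum ℤ := (primesEquiv (R := ℤ)).symm Pq with hvq
  set vℓ : HeightOneSpectrum ℤ := (primesEquiv (R := ℤ)).symm Pℓ with hvℓ
  have hPne : Pq ≠ Pℓ := fun h ↦ hqℓ (congrArg (fun P : Nat.Primes ↦ (P : ℕ)) h)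
  set N := W.conductorNorm ℤ with hN
  set N' := W'.conductorNorm ℤ with hN'
  have hN0 : N ≠ 0 := (W.conductorNorm_pos_holds).ne'
  have hN'0 : N' ≠ 0 := (W'.conductorNorm_pos_holds).ne'
  haveI : NeZero (W.conductorNorm ℤ) := ⟨hN0⟩
  haveI : NeZero (W'.conductorNorm ℤ) := ⟨hN'0⟩
  -- `d` is a square at `2` and at the odd bad primes other than `q`
  have hsq : ∀ p : Nat.Primes, ((p : ℕ) = 2 ∨ ((p : ℕ) ∣ N ∧ (p : ℕ) ≠ q)) →
      haveI := Fact.mk p.2; IsSquare ((d : ℤ) : ℚ_[p]) := by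
    intro p hp
    haveI := Fact.mk p.2
    by_cases hp2 : (p : ℕ) = 2
    · exact isSquare_padic_of_emod_eight_eq_one hp2 (by rw [hd]; exact h8)
    · rcases hp with h | ⟨hN, hpq⟩
      · exact absurd h hp2
      · exact isSquare_padic_of_jacobiSym_eq_one hp2 (hjac p p.2 hN hp2 hpq)
  have hndvd : ∀ p : Nat.Primes, p ≠ Pq → p ≠ Pℓ → ¬ ((natGenerator ((primesEquiv (R := ℤ)).symm p) : ℕ) : ℤ) ∣ d := by
    intro p hpq hpℓ h
    rw [natGenerator_symm, hd] at h
    rcases (Nat.prime_iff_prime_int.mp p.2).dvd_or_dvd h with h | h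
    · exact hpq (Subtype.ext ((Nat.prime_dvd_prime_iff_eq p.2 hq.out).mp (Int.natCast_dvd_natCast.mp h)))
    · exact hpℓ (Subtype.ext ((Nat.prime_dvd_prime_iff_eq p.2 hℓ.out).mp (Int.natCast_dvd_natCast.mp h)))
  -- reduction types of `W'` away from `q`, `ℓ` follow `W`
  have hred : ∀ p : Nat.Primes, p ≠ Pq → p ≠ Pℓ →
      ((W'.HasGoodReductionAt ((primesEquiv (R := ℤ)).symm p) ↔ W.HasGoodReductionAt ((primesEquiv (R := ℤ)).symm p)) ∧
      (W'.HasMultiplicativeReductionAt ((primesEquiv (R := ℤ)).symm p) ↔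
        W.HasMultiplicativeReductionAt ((primesEquiv (R := ℤ)).symm p)) ∧
      (W'.HasAdditiveReductionAt ((primesEquiv (R := ℤ)).symm p) ↔
        W.HasAdditiveReductionAt ((primesEquiv (R := ℤ)).symm p))) := by
    intro p hpq hpℓ
    by_cases hp2 : (p : ℕ) = 2
    · exact ⟨W.hasGoodReductionAt_quadraticTwist_iff_of_isSquare p hd0 (hsq p (Or.inl hp2)),
        W.hasMultiplicativeReductionAt_quadraticTwist_iff_of_isSquare p hd0 (hsq p (Or.inl hp2)),
        W.hasAdditiveReductionAt_quadraticTwist_iff_of_isSquare p hd0 (hsq p (Or.inl hp2))⟩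
    · exact W.hasReductionAt_quadraticTwist_iff_of_not_dvd _ (by rw [natGenerator_symm]; exact hp2) (hndvd p hpq hpℓ)
  -- additive primes are odd
  have hne2 : ∀ p : Nat.Primes, W.HasAdditiveReductionAt ((primesEquiv (R := ℤ)).symm p) → (p : ℕ) ≠ 2 := by
    intro p hp
    have h := h2 _ hp
    rw [Rat.ringChar_int_quotient_asIdeal, natGenerator_symm] at h
    omega
  have hne2' : ∀ p : Nat.Primes, p ≠ Pq → p ≠ Pℓ →
      W'.HasAdditiveReductionAt ((primesEquiv (R := ℤ)).symm p) → (p : ℕ) ≠ 2 :=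
    fun p hpq hpℓ hp ↦ hne2 p ((hred p hpq hpℓ).2.2.mp hp)
  -- quadratic-twist type is transported along twists by parameters prime to the prime in question
  have htt_tw : ∀ (u : ℤ) (hu0 : u ≠ 0) (R : Nat.Primes) (hR2 : (R : ℕ) ≠ 2)
      (hRu : ¬ ((natGenerator ((primesEquiv (R := ℤ)).symm R) : ℕ) : ℤ) ∣ u),
      W.HasAdditiveReductionAt ((primesEquiv (R := ℤ)).symm R) →
      ¬ ((W.quadraticTwist (u : ℚ)).quadraticTwist (((-1 : ℤ) ^ ((R : ℕ) / 2) * R : ℤ) : ℚ)).HasAdditiveReductionAt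
        ((primesEquiv (R := ℤ)).symm R) := by
    intro u hu0 R hR2 hRu ha
    have hrs0 : (((-1 : ℤ) ^ ((R : ℕ) / 2) * R : ℤ) : ℚ) ≠ 0 := by
      have : (-1 : ℤ) ^ ((R : ℕ) / 2) * R ≠ 0 := mul_ne_zero (pow_ne_zero _ (by norm_num)) (by exact_mod_cast R.2.ne_zero)
      exact_mod_cast this
    haveI := W.isElliptic_quadraticTwist hrs0
    have key : (W.quadraticTwist (u : ℚ)).quadraticTwist (((-1 : ℤ) ^ ((R : ℕ) / 2) * R : ℤ) : ℚ) =
        (W.quadraticTwist (((-1 : ℤ) ^ ((R : ℕ) / 2) * R : ℤ) : ℚ)).quadraticTwist (u : ℚ) := by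
      rw [quadraticTwist_quadraticTwist, quadraticTwist_quadraticTwist, mul_comm]
    rw [key, ((W.quadraticTwist _).hasReductionAt_quadraticTwist_iff_of_not_dvd _
      (by rw [natGenerator_symm]; exact hR2) hRu).2.2]
    exact htt R hR2 ha
  -- conductor exponents: `f = 2` at an odd additive prime of quadratic-twist type (`p ≥ 5`: always; `p = 3`: tame)
  have five_le := fun (X : WeierstrassCurve ℚ) [X.IsElliptic] (p : Nat.Primes) (hp5 : 5 ≤ (p : ℕ))
      (ha : X.HasAdditiveReductionAt ((primesEquiv (R := ℤ)).symm p)) ↦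
    Literature.NumberTheory.EllipticCurves.conductorExponent_eq_two_of_five_le_holds X
      ((primesEquiv (R := ℤ)).symm p) (by rw [natGenerator_symm]; exact hp5) ha
  have f_two : ∀ (X : WeierstrassCurve ℚ) [X.IsElliptic] (R : Nat.Primes) (hR2 : (R : ℕ) ≠ 2)
      (ha : X.HasAdditiveReductionAt ((primesEquiv (R := ℤ)).symm R))
      (hsemi : (R : ℕ) = 3 → ¬ (X.quadraticTwist (((-1 : ℤ) ^ ((R : ℕ) / 2) * R : ℤ) : ℚ)).HasAdditiveReductionAt
        ((primesEquiv (R := ℤ)).symm R)),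
      X.conductorExponent ((primesEquiv (R := ℤ)).symm R) = 2 :=
    fun X _ R hR2 ha hsemi ↦ TwistTypeConductor.conductorExponent_eq_two_of_twistType_odd X R hR2 ha hsemi
  have hfq' : W'.conductorExponent vq = 2 :=
    TwistRootNumberOdd.conductorExponent_quadraticTwist_eq_two_of_hasMultiplicativeReductionAtPrime W hq2 hqm hd0
      (by rw [hd]; exact dvd_mul_right _ _) (by
        rw [hd]; rintro ⟨w, hw⟩
        have hq0 : (q : ℤ) ≠ 0 := by exact_mod_cast hq.out.ne_zero
        have : (q : ℤ) ∣ ℓ := ⟨w, mul_left_cancel₀ hq0 (by rw [hw]; ring)⟩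
        exact hqℓ ((Nat.prime_dvd_prime_iff_eq hq.out hℓ.out).mp (Int.natCast_dvd_natCast.mp this)))
  have hmultq : W.HasMultiplicativeReductionAt vq :=
    (W.hasMultiplicativeReductionAtPrime_iff_hasMultiplicativeReductionAt_holds Pq).mp hqm
  have hfq : W.conductorExponent vq = 1 := (conductorExponent_eq_one_iff_holds vq W).mpr hmultq
  have haddℓ' : W'.HasAdditiveReductionAt vℓ :=
    W.hasAdditiveReductionAt_quadraticTwist_mul_of_hasGoodReductionAtPrime hℓ2 hqℓ hℓg
  have hfℓ' : W'.conductorExponent vℓ = 2 := five_le W' Pℓ hℓ5 haddℓ'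
  have hgoodℓ : W.HasGoodReductionAt vℓ := (W.hasGoodReductionAtPrime_iff_hasGoodReductionAt_holds Pℓ).mp hℓg
  have hfℓ : W.conductorExponent vℓ = 0 := (conductorExponent_eq_zero_iff_holds vℓ W).mpr hgoodℓ
  have hfeq : ∀ p : Nat.Primes, p ≠ Pq → p ≠ Pℓ →
      W'.conductorExponent ((primesEquiv (R := ℤ)).symm p) = W.conductorExponent ((primesEquiv (R := ℤ)).symm p) := by
    intro p hpq hpℓ
    obtain ⟨hg, hm, ha⟩ := hred p hpq hpℓ
    rcases hasGoodReductionAt_or_hasMultiplicativeReductionAt_or_hasAdditiveReductionAt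
      ((primesEquiv (R := ℤ)).symm p) W with h | h | h
    · rw [(conductorExponent_eq_zero_iff_holds _ W').mpr (hg.mpr h), (conductorExponent_eq_zero_iff_holds _ W).mpr h]
    · rw [(conductorExponent_eq_one_iff_holds _ W').mpr (hm.mpr h), (conductorExponent_eq_one_iff_holds _ W).mpr h]
    · have hp2' : (p : ℕ) ≠ 2 := hne2 p h
      rw [f_two W' p hp2' (ha.mpr h) (fun _ ↦ by rw [hW']; exact htt_tw d hd0 p hp2' (hndvd p hpq hpℓ) h),
        f_two W p hp2' h (fun _ ↦ htt p hp2' h)]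
  -- factorizations
  have hfac : ∀ (X : WeierstrassCurve ℚ) [X.IsElliptic] (p : Nat.Primes),
      (X.conductorNorm ℤ).factorization p = X.conductorExponent ((primesEquiv (R := ℤ)).symm p) := by
    intro X _ p
    have h := factorization_conductorNorm_holds X ((primesEquiv (R := ℤ)).symm p)
    rwa [natGenerator_symm] at h
  have hdvd_iff : ∀ (n : ℕ) (hn : n ≠ 0) (p : Nat.Primes), (p : ℕ) ∣ n ↔ n.factorization p ≠ 0 := by
    intro n hn p
    rw [Ne, Nat.factorization_eq_zero_iff]
    push Not
    exact ⟨fun h ↦ ⟨p.2, h, hn⟩, fun h ↦ h.2.1⟩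
  have hqN : (q : ℕ) ∣ N := (hdvd_iff N hN0 Pq).mpr (by rw [hfac W Pq, hfq]; norm_num)
  have hqqN : ¬ (q : ℕ) ^ 2 ∣ N := by
    rw [hq.out.pow_dvd_iff_le_factorization hN0, show N.factorization q = N.factorization Pq from rfl, hfac W Pq, hfq]
    omega
  have hℓN : ¬ (ℓ : ℕ) ∣ N := fun h ↦ (hdvd_iff N hN0 Pℓ).mp h (by rw [hfac W Pℓ, hfℓ])
  have hpf : N'.primeFactors = insert ℓ N.primeFactors := by
    ext r
    simp only [Finset.mem_insert, Nat.mem_primeFactors]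
    constructor
    · rintro ⟨hr, hrN', -⟩
      by_cases hrℓ : r = ℓ
      · exact Or.inl hrℓ
      · refine Or.inr ⟨hr, ?_, hN0⟩
        by_cases hrq : r = q
        · rw [hrq]; exact hqN
        · have h := (hdvd_iff N' hN'0 ⟨r, hr⟩).mp hrN'
          rw [hfac W' ⟨r, hr⟩, hfeq ⟨r, hr⟩ (fun h ↦ hrq (congrArg Subtype.val h))
            (fun h ↦ hrℓ (congrArg Subtype.val h)), ← hfac W ⟨r, hr⟩] at h
          exact (hdvd_iff N hN0 ⟨r, hr⟩).mpr h
    · rintro (rfl | ⟨hr, hrN, -⟩)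
      · exact ⟨hℓ.out, (hdvd_iff N' hN'0 Pℓ).mpr (by rw [hfac W' Pℓ, hfℓ']; norm_num), hN'0⟩
      · refine ⟨hr, ?_, hN'0⟩
        by_cases hrq : r = q
        · subst hrq; exact (hdvd_iff N' hN'0 Pq).mpr (by rw [hfac W' Pq, hfq']; norm_num)
        · have hrℓ : r ≠ ℓ := fun h ↦ hℓN (h ▸ hrN)
          have h := (hdvd_iff N hN0 ⟨r, hr⟩).mp hrN
          rw [hfac W ⟨r, hr⟩, ← hfeq ⟨r, hr⟩ (fun h ↦ hrq (congrArg Subtype.val h))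
            (fun h ↦ hrℓ (congrArg Subtype.val h)), ← hfac W' ⟨r, hr⟩] at h
          exact (hdvd_iff N' hN'0 ⟨r, hr⟩).mpr h
  -- the bound `hle` for the twists of `W'` and of `W` by `p*`
  have hle' : ∀ p : Nat.Primes, (p : ℕ) ≠ 2 → ∀ v : HeightOneSpectrum ℤ, natGenerator v ≠ p →
      W'.HasAdditiveReductionAt v →
      (W'.quadraticTwist (((-1 : ℤ) ^ ((p : ℕ) / 2) * p : ℤ) : ℚ)).conductorExponent v ≤ W'.conductorExponent v := by
    intro p hp2 v hvp hadd
    obtain ⟨r, rfl⟩ := (primesEquiv (R := ℤ)).symm.surjective v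
    rw [natGenerator_symm] at hvp
    have hrp : r ≠ p := fun h ↦ hvp (congrArg Subtype.val h)
    have hps0 : (((-1 : ℤ) ^ ((p : ℕ) / 2) * p : ℤ) : ℚ) ≠ 0 := by
      have : (-1 : ℤ) ^ ((p : ℕ) / 2) * p ≠ 0 := mul_ne_zero (pow_ne_zero _ (by norm_num)) (by exact_mod_cast p.2.ne_zero)
      exact_mod_cast this
    haveI := W'.isElliptic_quadraticTwist hps0
    haveI := Fact.mk p.2
    by_cases hrq : r = Pq
    · -- at `q`: both are `2` (Kodaira `Iₙ*`)
      have hpq : (q : ℕ) ≠ (p : ℕ) := fun h ↦ hvp (by rw [hrq, ← h])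
      have key : W'.quadraticTwist ((((-1 : ℤ) ^ ((p : ℕ) / 2) * p : ℤ)) : ℚ) =
          W.quadraticTwist (((d * ((-1 : ℤ) ^ ((p : ℕ) / 2) * p)) : ℤ) : ℚ) := by
        rw [hW', quadraticTwist_quadraticTwist]; push_cast; ring_nf
      have hD0' : d * ((-1 : ℤ) ^ ((p : ℕ) / 2) * p) ≠ 0 :=
        mul_ne_zero hd0 (mul_ne_zero (pow_ne_zero _ (by norm_num)) (by exact_mod_cast p.2.ne_zero))
      have h1 : (q : ℤ) ∣ d * ((-1 : ℤ) ^ ((p : ℕ) / 2) * p) := by rw [hd]; exact (dvd_mul_right _ _).mul_right _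
      have h2 : ¬ (q : ℤ) ^ 2 ∣ d * ((-1 : ℤ) ^ ((p : ℕ) / 2) * p) := by
        rw [hd]
        intro h
        have hqZ : Prime (q : ℤ) := Nat.prime_iff_prime_int.mp hq.out
        have h' : (q : ℤ) * q ∣ q * (ℓ * ((-1 : ℤ) ^ ((p : ℕ) / 2) * p)) := by rw [← sq, ← mul_assoc]; exact h
        have h'' : (q : ℤ) ∣ ℓ * ((-1 : ℤ) ^ ((p : ℕ) / 2) * p) :=
          (mul_dvd_mul_iff_left (by exact_mod_cast hq.out.ne_zero)).mp h'
        rcases hqZ.dvd_or_dvd h'' with h3 | h3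
        · exact hqℓ ((Nat.prime_dvd_prime_iff_eq hq.out hℓ.out).mp (Int.natCast_dvd_natCast.mp h3))
        · have h4 : (q : ℤ) ∣ (p : ℤ) := ((isUnit_neg_one (α := ℤ)).pow _).dvd_mul_left.mp h3
          exact hpq ((Nat.prime_dvd_prime_iff_eq hq.out p.2).mp (Int.natCast_dvd_natCast.mp h4))
      have hrq' : (primesEquiv (R := ℤ)).symm r = vq := by rw [hrq]
      rw [hrq', hfq', key]
      exact (TwistRootNumberOdd.conductorExponent_quadraticTwist_eq_two_of_hasMultiplicativeReductionAtPrime W hq2 hqm hD0' h1 h2).le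
    · -- elsewhere: an odd additive prime of twist type (or `ℓ ≥ 5`), both are `2`
      have hadd2 : (W'.quadraticTwist (((-1 : ℤ) ^ ((p : ℕ) / 2) * p : ℤ) : ℚ)).HasAdditiveReductionAt
          ((primesEquiv (R := ℤ)).symm r) :=
        ((W'.hasReductionAt_quadraticTwist_pStar_iff (p := (p : ℕ)) hp2 _
          (by rw [natGenerator_symm]; exact hvp)).2.2).mpr hadd
      by_cases hrℓ : r = Pℓ
      · have hr5 : 5 ≤ (r : ℕ) := by rw [hrℓ]; exact hℓ5
        rw [five_le _ r hr5 hadd2, five_le W' r hr5 hadd]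
      · have haddW : W.HasAdditiveReductionAt ((primesEquiv (R := ℤ)).symm r) := (hred r hrq hrℓ).2.2.mp hadd
        have hr2 : (r : ℕ) ≠ 2 := hne2 r haddW
        have hru : ¬ ((natGenerator ((primesEquiv (R := ℤ)).symm r) : ℕ) : ℤ) ∣ d * ((-1 : ℤ) ^ ((p : ℕ) / 2) * p) := by
          intro h
          rcases (Nat.prime_iff_prime_int.mp (prime_natGenerator _)).dvd_or_dvd h with h | h
          · exact hndvd r hrq hrℓ h
          · rw [natGenerator_symm] at h
            exact hrp (Subtype.ext ((Nat.prime_dvd_prime_iff_eq r.2 p.2).mp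
              (Int.natCast_dvd_natCast.mp (((isUnit_neg_one (α := ℤ)).pow _).dvd_mul_left.mp h))))
        have hD0' : d * ((-1 : ℤ) ^ ((p : ℕ) / 2) * p) ≠ 0 :=
          mul_ne_zero hd0 (mul_ne_zero (pow_ne_zero _ (by norm_num)) (by exact_mod_cast p.2.ne_zero))
        have keyD : W'.quadraticTwist (((-1 : ℤ) ^ ((p : ℕ) / 2) * p : ℤ) : ℚ) =
            W.quadraticTwist (((d * ((-1 : ℤ) ^ ((p : ℕ) / 2) * p)) : ℤ) : ℚ) := by
          rw [hW', quadraticTwist_quadraticTwist]; push_cast; ring_nf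
        rw [f_two _ r hr2 hadd2 (fun _ ↦ by rw [keyD]; exact htt_tw _ hD0' r hr2 hru haddW),
          f_two W' r hr2 hadd (fun _ ↦ by rw [hW']; exact htt_tw d hd0 r hr2 (hndvd r hrq hrℓ) haddW)]
  have hle : ∀ p : Nat.Primes, (p : ℕ) ≠ 2 → ∀ v : HeightOneSpectrum ℤ, natGenerator v ≠ p →
      W.HasAdditiveReductionAt v →
      (W.quadraticTwist (((-1 : ℤ) ^ ((p : ℕ) / 2) * p : ℤ) : ℚ)).conductorExponent v ≤ W.conductorExponent v := by
    intro p hp2 v hvp hadd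
    obtain ⟨r, rfl⟩ := (primesEquiv (R := ℤ)).symm.surjective v
    rw [natGenerator_symm] at hvp
    have hrp' : r ≠ p := fun h ↦ hvp (congrArg Subtype.val h)
    have hps0 : (((-1 : ℤ) ^ ((p : ℕ) / 2) * p : ℤ) : ℚ) ≠ 0 := by
      have : (-1 : ℤ) ^ ((p : ℕ) / 2) * p ≠ 0 := mul_ne_zero (pow_ne_zero _ (by norm_num)) (by exact_mod_cast p.2.ne_zero)
      exact_mod_cast this
    haveI := W.isElliptic_quadraticTwist hps0
    haveI := Fact.mk p.2
    have hr2 : (r : ℕ) ≠ 2 := hne2 r hadd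
    have hadd2 : (W.quadraticTwist (((-1 : ℤ) ^ ((p : ℕ) / 2) * p : ℤ) : ℚ)).HasAdditiveReductionAt
        ((primesEquiv (R := ℤ)).symm r) :=
      ((W.hasReductionAt_quadraticTwist_pStar_iff (p := (p : ℕ)) hp2 _
        (by rw [natGenerator_symm]; exact hvp)).2.2).mpr hadd
    have hrps : ¬ ((natGenerator ((primesEquiv (R := ℤ)).symm r) : ℕ) : ℤ) ∣ ((-1 : ℤ) ^ ((p : ℕ) / 2) * p) := by
      intro h
      rw [natGenerator_symm] at h
      exact hrp' (Subtype.ext ((Nat.prime_dvd_prime_iff_eq r.2 p.2).mp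
        (Int.natCast_dvd_natCast.mp (((isUnit_neg_one (α := ℤ)).pow _).dvd_mul_left.mp h))))
    have hps0Z : ((-1 : ℤ) ^ ((p : ℕ) / 2) * p : ℤ) ≠ 0 :=
      mul_ne_zero (pow_ne_zero _ (by norm_num)) (by exact_mod_cast p.2.ne_zero)
    rw [f_two _ r hr2 hadd2 (fun _ ↦ htt_tw _ hps0Z r hr2 hrps hadd), f_two W r hr2 hadd (fun _ ↦ htt r hr2 hadd)]
  -- newforms
  obtain ⟨f, hf⟩ := hmod W
  obtain ⟨f', hf'⟩ := hmod W'
  have hε := IsNewform0.frickeEigenvalue_eq_prod_atkinLehnerEigenvalueAt_holds hf.1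
  have hε' := IsNewform0.frickeEigenvalue_eq_prod_atkinLehnerEigenvalueAt_holds hf'.1
  -- `λ_q(f') = χ₄ q`, `λ_ℓ(f') = χ₄ ℓ`
  have haddq' : W'.HasAdditiveReductionAt vq := (two_le_conductorExponent_iff_holds vq W').mp (by rw [hfq'])
  have hlamq_tw : atkinLehnerEigenvalueAt f' q = (ZMod.χ₄ q : ℂ) :=
    W'.atkinLehnerEigenvalueAt_eq_χ₄_of_twist_of_le hmod hf' Pq hq2 haddq'
      (W.not_hasAdditiveReductionAt_quadraticTwist_mul_pStar_left hq2 hqℓ hqm) hfq' (hle' Pq hq2)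
  have hlaml_tw : atkinLehnerEigenvalueAt f' ℓ = (ZMod.χ₄ ℓ : ℂ) :=
    W'.atkinLehnerEigenvalueAt_eq_χ₄_of_twist_of_le hmod hf' Pℓ hℓ2 haddℓ'
      (W.not_hasAdditiveReductionAt_quadraticTwist_mul_pStar_right hℓ2 hqℓ hℓg) hfℓ' (hle' Pℓ hℓ2)
  -- `λ_q(f) = 1`
  have hlamq : atkinLehnerEigenvalueAt f q = 1 := by
    have h := W.atkinLehnerEigenvalueAt_eq_localRootNumberAt_of_not_sq_dvd hf Pq hqN hqqN
    rw [h, localRootNumberAt_primesEquiv_symm_eq, localRootNumber_of_hasMultiplicativeReduction _ _ hqm hqns]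
    simp
  -- `λ_r(f') = λ_r(f)` at the other primes of `N`
  have hlam_eq : ∀ r ∈ N.primeFactors.erase q, atkinLehnerEigenvalueAt f' r = atkinLehnerEigenvalueAt f r := by
    intro r hr
    obtain ⟨hrq, hrN⟩ := Finset.mem_erase.mp hr
    obtain ⟨hrp, hrdvd, -⟩ := Nat.mem_primeFactors.mp hrN
    have hrℓ : r ≠ ℓ := fun h ↦ hℓN (h ▸ hrdvd)
    set R : Nat.Primes := ⟨r, hrp⟩
    have hRq : R ≠ Pq := fun h ↦ hrq (congrArg Subtype.val h)
    have hRℓ : R ≠ Pℓ := fun h ↦ hrℓ (congrArg Subtype.val h)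
    haveI := Fact.mk hrp
    have hbad : ¬ W.HasGoodReductionAt ((primesEquiv (R := ℤ)).symm R) := fun hg ↦
      ((W.dvd_conductorNorm_iff_not_hasGoodReductionAtPrime r).mp hrdvd)
        ((W.hasGoodReductionAtPrime_iff_hasGoodReductionAt_holds R).mpr hg)
    rcases hasGoodReductionAt_or_hasMultiplicativeReductionAt_or_hasAdditiveReductionAt
      ((primesEquiv (R := ℤ)).symm R) W with h | hm | ha
    · exact absurd h hbad
    · -- multiplicative: both are the local root number, and `W' ≅ W` over `ℚ_r`
      have hf1 : W.conductorExponent ((primesEquiv (R := ℤ)).symm R) = 1 := (conductorExponent_eq_one_iff_holds _ W).mpr hm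
      have hf1' : W'.conductorExponent ((primesEquiv (R := ℤ)).symm R) = 1 := by rw [hfeq R hRq hRℓ, hf1]
      have hrN' : r ∣ N' := (hdvd_iff N' hN'0 R).mpr (by rw [hfac W' R, hf1']; norm_num)
      have hrrN' : ¬ r ^ 2 ∣ N' := by
        rw [hrp.pow_dvd_iff_le_factorization hN'0, show N'.factorization r = N'.factorization R from rfl, hfac W' R, hf1']
        omega
      have hrrN : ¬ r ^ 2 ∣ N := by
        rw [hrp.pow_dvd_iff_le_factorization hN0, show N.factorization r = N.factorization R from rfl, hfac W R, hf1]
        omega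
      rw [W'.atkinLehnerEigenvalueAt_eq_localRootNumberAt_of_not_sq_dvd hf' R hrN' hrrN',
        W.atkinLehnerEigenvalueAt_eq_localRootNumberAt_of_not_sq_dvd hf R hrdvd hrrN,
        W.localRootNumberAt_quadraticTwist_of_isSquare R hd0 (hsq R (by
          by_cases h2 : r = 2
          · exact Or.inl h2
          · exact Or.inr ⟨hrdvd, hrq⟩))]
    · -- additive (odd, twist type): both are `χ₄ r`
      have hr2 : r ≠ 2 := hne2 R ha
      have hps0 : (((-1 : ℤ) ^ (r / 2) * r : ℤ) : ℚ) ≠ 0 := by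
        have : (-1 : ℤ) ^ (r / 2) * r ≠ 0 := mul_ne_zero (pow_ne_zero _ (by norm_num)) (by exact_mod_cast hrp.ne_zero)
        exact_mod_cast this
      haveI := W.isElliptic_quadraticTwist hps0
      have hsemi := htt R hr2 ha
      have ha' : W'.HasAdditiveReductionAt ((primesEquiv (R := ℤ)).symm R) := (hred R hRq hRℓ).2.2.mpr ha
      have hsemi' : ¬ (W'.quadraticTwist (((-1 : ℤ) ^ ((R : ℕ) / 2) * R : ℤ) : ℚ)).HasAdditiveReductionAt
          ((primesEquiv (R := ℤ)).symm R) := by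
        have key : W'.quadraticTwist (((-1 : ℤ) ^ ((R : ℕ) / 2) * R : ℤ) : ℚ) =
            (W.quadraticTwist (((-1 : ℤ) ^ ((R : ℕ) / 2) * R : ℤ) : ℚ)).quadraticTwist (d : ℚ) := by
          rw [hW', quadraticTwist_quadraticTwist, quadraticTwist_quadraticTwist, mul_comm]
        rw [key, ((W.quadraticTwist _).hasReductionAt_quadraticTwist_iff_of_not_dvd _
          (by rw [natGenerator_symm]; exact hr2) (hndvd R hRq hRℓ)).2.2]
        exact hsemi
      rw [W'.atkinLehnerEigenvalueAt_eq_χ₄_of_twist_of_le hmod hf' R hr2 ha' hsemi' (f_two W' R hr2 ha' (fun _ ↦ hsemi'))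
          (hle' R hr2),
        W.atkinLehnerEigenvalueAt_eq_χ₄_of_twist_of_le hmod hf R hr2 ha hsemi (f_two W R hr2 ha (fun _ ↦ hsemi)) (hle R hr2)]
  -- the products
  have hqmem : q ∈ N.primeFactors := Nat.mem_primeFactors.mpr ⟨hq.out, hqN, hN0⟩
  have hℓmem : ℓ ∉ N.primeFactors := fun h ↦ hℓN (Nat.mem_primeFactors.mp h).2.1
  have hP : ∏ r ∈ N.primeFactors.erase q, atkinLehnerEigenvalueAt f' r =
      ∏ r ∈ N.primeFactors.erase q, atkinLehnerEigenvalueAt f r := Finset.prod_congr rfl hlam_eq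
  have hχ : (ZMod.χ₄ ℓ : ℂ) * (ZMod.χ₄ q : ℂ) = 1 := by
    have h4 : ((ℓ : ZMod 4) * (q : ZMod 4)) = 1 := by
      have hmod : ((ℓ * q : ℕ) : ℤ) % 4 = 1 := by push_cast; rw [mul_comm]; omega
      have hmod' : (ℓ * q) % 4 = 1 := by exact_mod_cast hmod
      rw [← Nat.cast_mul, ← ZMod.natCast_mod, hmod', Nat.cast_one]
    have h : ZMod.χ₄ ℓ * ZMod.χ₄ q = 1 := by rw [← map_mul, h4, map_one]
    exact_mod_cast congrArg (fun z : ℤ ↦ (z : ℂ)) h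
  have hεeq : frickeEigenvalue f' = frickeEigenvalue f := by
    rw [hε', hε, hpf, Finset.prod_insert hℓmem, ← Finset.mul_prod_erase _ _ hqmem,
      ← Finset.mul_prod_erase N.primeFactors _ hqmem, hlaml_tw, hlamq_tw, hlamq, hP, ← mul_assoc, hχ]
  have hw' := rootNumber_eq_neg_frickeEigenvalue (W := W') (fun _ _ ↦ IsNewform0.exists_functional_equation_holds)
    (fun _ _ ↦ IsNewform0.frickeEigenvalue_eq_one_or_eq_neg_one_holds) hf'
  have hw := rootNumber_eq_neg_frickeEigenvalue (W := W) (fun _ _ ↦ IsNewform0.exists_functional_equation_holds)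
    (fun _ _ ↦ IsNewform0.frickeEigenvalue_eq_one_or_eq_neg_one_holds) hf
  have h : ((W'.rootNumber : ℤ) : ℂ) = ((W.rootNumber : ℤ) : ℂ) := by rw [hw', hw, hεeq]
  exact_mod_cast h


end Summit.BirchSwinnertonDyer.BirchSwinnertonDyer.Theorems.TwistRootNumberOddThree

end
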